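import Summits.CriticalPhenomena.SAWScalingLimit.Theses.SAWRenewalTightness
import Summits.CriticalPhenomena.SAWScalingLimit.Theses.SAWLoopFugacityFlow
import Summits.CriticalPhenomena.SAWScalingLimit.Theorems.SubseqIdentification.Negative.Necessity
import Summits.CriticalPhenomena.SAWScalingLimit.Theorems.SimpleSubseqLimits.Negative.SimpleSubseqLimitsNecessary
import Literature.Probability.RandomPlanarGeometry.SelfAvoidingWalk
import Literature.Probability.RandomPlanarGeometry.ConformalWelding
import Literature.Probability.RandomPlanarGeometry.SimpleCurveLaws
import Literature.Probability.RandomPlanarGeometry.NaturalParametrization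
import Literature.Probability.RandomPlanarGeometry.ChordalReversibility

/-!
# Line `two-point-pivot-rigidity` — skeleton for crux `SubseqIdentification` (stmt-CriticalPhenomena-0783)

Crux (route `SAWRenewalTightness`, decl shared verbatim by `SAWParafermion`, `SAWLeftRightFKG`,
`SAWAsymptoticMorera`, `SAWLoopFugacityFlow`, …; the ledger dedups):

  `∀ D a b, IsEndpointApprox D a b → ∀ s μ, s → 0⁺ → IsProbabilityMeasure μ →`
  `(∀ f ∈ C_b, ∫ f∘curve dP^{SAW}_{D, s n} → ∫ f dμ) → IsSLELaw (8/3) D μ`.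

Idea (card `Ideas/two-point-pivot-rigidity.md`, triage r1-1/2/3: pass ×3). INTERNALISE THE SQUARE:
the critical SAW law is uniform given the length, so it is invariant under every fixed-endpoint
two-point transformation of Madras–Orlitsky–Shepp / Madras–Slade §9.6.2 (reflect the sub-walk
between two visits of a lattice line in that line — four lattice directions; half-turn of a sub-walk
about the midpoint of two of its vertices; reflect it in their perpendicular bisector) composed with
"accept iff the image is again a SAW of `Ω_δ`", and the product of two critical SAW laws is invariant
under arc SWAPS between two common vertices. In flux form this is EXACT DETAILED BALANCE at every
mesh (§0, proved here: `pivotFlux_symm`). What survives `δ → 0` along the crux's subsequence, after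
normalising the counting measure of ACCEPTED MACROSCOPIC pivot pairs (abundant: `≍ N^{2-2p}` pairs,
but exceptional), is a PAIR-INTENSITY KERNEL `K_γ` on move parameters `(kind, p, q)` for which the
single limit `μ` satisfies detailed balance (`IsPivotKernel.balance`), which charges every admissible
move window (`ample`, the lower bound triage r1-1 asked to be filed) and which is a LOCAL functional of
the curve (`isLocal`, the kernel-fixing clause triage r1-2 asked for). The bet of the line
(`stub_pivotRigidity`, Kennedy's continuum-pivot question in two-point form) is that such a structure
forces `μ ≪ SLE_{8/3}(D)` with a MOVE-INVARIANT density (c ≠ 0 laws fail balance by the non-local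
loop-measure cocycle; affine images fail it for the diagonal mirrors; conditioned / reweighted SLE fail
`ample`/`isLocal`) — the conclusion class triage r1-1/r1-3 showed to be the right one (`φ(M)·SLE_{8/3}`
IS balanced for every density `φ` of the Minkowski content; "closed convex hull of `μ_s`" was too
small). Two-copy swaps (`stub_swapKernel`) plus EXACT LATTICE SCALING along a corner chain and
uniform two-sided non-degeneracy (all inside `stub_untilt`) then kill every move-invariant tilt.

Shape: four registered stubs

* `stub_pivotKernel`   — L1′ ∧ L1″ ∧ L1‴: lattice Campbell identity ⇒ limit pair-intensity kernel;
* `stub_pivotRigidity` — L3 (restated): pivot kernels at all small scales ⇒ move-invariant tilt of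
                          SLE_{8/3}(D)  [HARDEST; the bet QCU ∧ PIN of the card];
* `stub_swapKernel`    — M4: product law uniform given total length ⇒ limit swap-intensity kernel;
* `stub_untilt`        — L3⊗ (Cauchy step) ∧ exact mesh-doubling scaling ∧ L5 ⇒ the tilt is trivial;

and the SORRY-FREE composition `SubseqIdentification_of`, which concludes the crux decl BY NAME from
the four stubs and two REGISTERED OBLIGATIONS of the hub taken as hypotheses by name:
`SAWRenewalTightness.EventualTight` (stmt-CriticalPhenomena-1372, this route's own target (T′):
auxiliary subsequential limits along the corner chain) and `SAWLoopFugacityFlow.SimpleSubseqLimits`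
(stmt-CriticalPhenomena-4982 = L6 of the card; PROVABLY NECESSARY for the crux:
`Theorems/SimpleSubseqLimits/Negative/SimpleSubseqLimitsNecessary`, so assuming it costs nothing).

Disproof.lean (cdisprove cycle 1, NO KILL) honoured: every lattice statement is along `𝓝[>] 0`
(`_false_without_oneSided/_meshToZero`: the kernel is a `δ → 0` renormalised object, meaningless at
fixed mesh), and the endpoint limits enter through `IsSimpleChord` (source `= D.pt 0`, target
`= D.pt 1`; `_false_without_endpointLimits/_fstLimit/_sndLimit`, §3 `ae_endpoints_of_hyps` =
landed `Negative.Necessity`). §4.7 (any proof must spend the square symmetry of `ℤ² ⊂ ℂ`): the four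
mirror directions `latticeDir` and the integer mesh refinement of `stub_untilt`. No stub is an
instance of a landed Negative lemma (those concern coincident / non-converging endpoints, excluded by
`IsSubseqLimit`). Negatives index (stmt-0772 all-δ `Tight`, stmt-5420, …) untouched.
-/

noncomputable section

open MeasureTheory Filter Topology Set Function
open scoped NNReal ENNReal BoundedContinuousFunction ComplexConjugate
open Literature.Probability.RandomPlanarGeometry Literature.Probability.RandomPlanarGeometry.SAW
open Literature.Probability.LatticeModels
open Summit.CriticalPhenomena.SAWScalingLimit.Theses.SAWRenewalTightness (EventualTight SubseqIdentification)
open Summit.CriticalPhenomena.SAWScalingLimit.Theses.SAWLoopFugacityFlow (SimpleSubseqLimits)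

namespace Summit.CriticalPhenomena.SAWScalingLimit.Cruxes.SubseqIdentification.TwoPointPivotRigidity

/-! ## §0 The exact lattice engine (PROVED): uniform-given-length ⇒ detailed balance in flux form

`SAW.law Ω δ a b ∝ Σ_γ x_c^{|γ|} δ_γ` is invariant under every length-preserving bijection of
`DomainSAW Ω δ a b` (ideator's lemma, re-hosted), hence for a length-preserving INVOLUTION `T` (each
two-point pivot "move if the image is a SAW of `Ω_δ`, else stay" is one) the flux `(id, T)_* law` is
symmetric under `Prod.swap`: exact detailed balance at every mesh, the identity whose normalised
`δ → 0` limit `stub_pivotKernel` extracts. Sums over finite families of such `T` stay symmetric. -/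

section Lattice

variable {Ω : Set ℂ} {δ : ℝ} {a b : Site 2}

/-- The critical weight is invariant under any length-preserving bijection of the SAWs (crux-ideate
sketch `PivotSketch.weight_map_eq_of_length_preserving`, re-hosted verbatim). [folklore] -/
theorem weight_map_eq_of_length_preserving (T : DomainSAW Ω δ a b → DomainSAW Ω δ a b)
    (hT : Function.Bijective T) (hlen : ∀ γ, (T γ).length = γ.length) :
    (SAW.weight Ω δ a b).map T = SAW.weight Ω δ a b := by
  have hTm : Measurable T := DomainSAW.measurable_of_top T
  refine Measure.ext fun s hs => ?_
  rw [Measure.map_apply hTm hs]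
  have key : ∀ (u : Set (DomainSAW Ω δ a b)), SAW.weight Ω δ a b u =
      ∑' γ, ENNReal.ofReal (criticalFugacity ^ γ.length) * u.indicator 1 γ := by
    intro u
    rw [SAW.weight, Measure.sum_apply _ MeasurableSpace.measurableSet_top]
    refine tsum_congr fun γ => ?_
    rw [Measure.smul_apply, smul_eq_mul, Measure.dirac_apply' _ MeasurableSpace.measurableSet_top]
  rw [key, key]
  let e : DomainSAW Ω δ a b ≃ DomainSAW Ω δ a b := Equiv.ofBijective T hT
  have h1 : ∀ γ, ENNReal.ofReal (criticalFugacity ^ γ.length) * (T ⁻¹' s).indicator 1 γ =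
      (fun γ' => ENNReal.ofReal (criticalFugacity ^ γ'.length) * s.indicator 1 γ') (e γ) := by
    intro γ
    show _ = ENNReal.ofReal (criticalFugacity ^ (T γ).length) * s.indicator 1 (T γ)
    rw [hlen γ]
    congr 1
  rw [tsum_congr h1]
  exact Equiv.tsum_eq e (fun γ' => ENNReal.ofReal (criticalFugacity ^ γ'.length) * s.indicator 1 γ')

/-- **L0.** A length-preserving bijection of the SAWs of `Ω_δ` from `a` to `b` preserves the critical
SAW law ("the critical SAW is uniform given its length"). [folklore] -/
theorem law_map_eq_of_length_preserving (T : DomainSAW Ω δ a b → DomainSAW Ω δ a b)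
    (hT : Function.Bijective T) (hlen : ∀ γ, (T γ).length = γ.length) :
    (SAW.law Ω δ a b).map T = SAW.law Ω δ a b := by
  rw [SAW.law, Measure.map_smul, weight_map_eq_of_length_preserving T hT hlen]

/-- **L0 in flux form: exact lattice detailed balance.** For a length-preserving involution `T` of the
SAWs of `Ω_δ` (a two-point pivot with the accept/reject rule), the flux `(id, T)_* P_δ` on pairs
(configuration, moved configuration) is symmetric. Summing over the finitely many pivot moves
`(i, j, g)` gives the symmetric lattice flux `Θ_δ` whose renormalised limit is `stub_pivotKernel`.
[folklore] -/
theorem pivotFlux_symm (T : DomainSAW Ω δ a b → DomainSAW Ω δ a b) (hT : Function.Involutive T)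
    (hlen : ∀ γ, (T γ).length = γ.length) :
    ((SAW.law Ω δ a b).map fun γ => (γ, T γ)).map Prod.swap =
      (SAW.law Ω δ a b).map fun γ => (γ, T γ) := by
  have hm : ∀ f : DomainSAW Ω δ a b → DomainSAW Ω δ a b × DomainSAW Ω δ a b, Measurable f :=
    fun f => DomainSAW.measurable_of_top f
  rw [Measure.map_map measurable_swap (hm _)]
  have hcomp : (Prod.swap ∘ fun γ => (γ, T γ)) = (fun γ => (γ, T γ)) ∘ T := by
    funext γ
    simp [Function.comp, hT γ]
  rw [hcomp, ← Measure.map_map (hm _) (DomainSAW.measurable_of_top T),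
    law_map_eq_of_length_preserving T hT.bijective hlen]

end Lattice

/-! ## §1 Two-point moves of simple chords (range level; the continuum shadows of M1, M2, M2′)

A move of the simple chord `γ` of `(D; a, b)` is specified by two points `p ≠ q` of its trace and a
lattice isometry `g` with `g {p, q} = {p, q}`: the closed sub-arc `S = γ[p, q]` is replaced by
`g(S)`. It is ADMISSIBLE iff the new trace is again the trace of a simple chord of `D` (which is then
unique: `IsMoveVia.unique`), and NON-TRIVIAL iff that chord differs from `γ`. Everything is stated on
traces; no parametrised splicing is needed. -/

/-- The four mirror directions of `ℤ² ⊂ ℂ` (axes and diagonals): where the square symmetry of the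
embedded lattice enters (Disproof §4.7; barrier `EmbeddingModulusUniqueness`: on `diag(1,λ)ℤ²` only
the two axis mirrors survive and the same scheme returns the sheared limit). -/
def latticeDir : Fin 4 → ℂ := ![1, Complex.I, 1 + Complex.I, 1 - Complex.I]

/-- Reflection of the plane in the line through `c` with direction `d ≠ 0`. -/
def lineReflect (c d : ℂ) (z : ℂ) : ℂ := c + d / conj d * conj (z - c)

/-- The kinds of fixed-endpoint two-point moves (Madras–Slade §9.6.2, Fig. 9.10; Madras–Orlitsky–Shepp
1990): `mirror k` (M1) reflect the middle arc in the lattice line of direction `latticeDir k` through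
`p` and `q`; `invert` (M2) half-turn of the middle arc about `(p+q)/2`; `bisector k` (M2′) reflect the
middle arc in the perpendicular bisector of `[p, q]` (a lattice symmetry iff `q - p ∥ latticeDir k`). -/
inductive MoveKind
  | mirror (k : Fin 4)
  | invert
  | bisector (k : Fin 4)

/-- Discrete σ-algebra on the finite parameter `MoveKind`. -/
instance : MeasurableSpace MoveKind := ⊤

namespace MoveKind

/-- Lattice compatibility of the pivots: for mirrors and bisector reflections `q - p` must point in
the chosen lattice direction (so that the isometry maps `{p, q}` to itself and `δℤ²`-polylines with
these pivots to `δℤ²`-polylines); the half-turn is always available. -/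
def Compatible : MoveKind → ℂ → ℂ → Prop
  | mirror k, p, q => ∃ t : ℝ, q - p = (t : ℂ) * latticeDir k
  | invert, _, _ => True
  | bisector k, p, q => ∃ t : ℝ, q - p = (t : ℂ) * latticeDir k

/-- The isometry of the move with pivots `p, q`. -/
def isometry : MoveKind → ℂ → ℂ → ℂ → ℂ
  | mirror k, p, _ => lineReflect p (latticeDir k)
  | invert, p, q => fun z => p + q - z
  | bisector k, p, q => lineReflect ((p + q) / 2) (Complex.I * latticeDir k)

end MoveKind

/-- The closed sub-arc of the trace `R` between `p` and `q`: the intersection of all preconnected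
subsets of `R` containing both (for an arc `R ∋ p, q` this is the sub-arc `[p, q]`). -/
def subarc (R : Set ℂ) (p q : ℂ) : Set ℂ :=
  ⋂₀ {C : Set ℂ | C ⊆ R ∧ IsPreconnected C ∧ p ∈ C ∧ q ∈ C}

/-- The trace after moving the sub-arc between `p` and `q` by `g` (outer arcs fixed). -/
def movedRange (R : Set ℂ) (p q : ℂ) (g : ℂ → ℂ) : Set ℂ :=
  (R \ subarc R p q) ∪ g '' subarc R p q

/-- `γ'` is obtained from the simple chord `γ` of `(D; a, b)` by the ADMISSIBLE, NON-TRIVIAL two-point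
move `(κ, p, q)`: both are simple chords of `D` (simple, from `a` to `b`, in `D̄`, meeting `∂D` only
at `a, b`), they differ, `p ≠ q` are lattice-compatible points of `γ`, and the trace of `γ'` is the
moved trace. -/
def IsMoveVia (D : DobrushinDomain) (κ : MoveKind) (p q : ℂ) (γ γ' : CurveClass ℂ) : Prop :=
  D.IsSimpleChord γ ∧ D.IsSimpleChord γ' ∧ γ' ≠ γ ∧ p ∈ γ.range ∧ q ∈ γ.range ∧ p ≠ q ∧
    κ.Compatible p q ∧ γ'.range = movedRange γ.range p q (κ.isometry p q)

/-- The two-point move relation at scale `r`: some admissible non-trivial move with `|p - q| ≥ r`. -/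
def IsMove (D : DobrushinDomain) (r : ℝ) (γ γ' : CurveClass ℂ) : Prop :=
  ∃ (κ : MoveKind) (p q : ℂ), r ≤ dist p q ∧ IsMoveVia D κ p q γ γ'

/-- The moved chord is unique (a simple class is determined by its trace and its starting point,
`CurveClass.eq_of_mem_simple_of_range_eq`), so the move map below is canonical. [folklore] -/
theorem IsMoveVia.unique {D : DobrushinDomain} {κ : MoveKind} {p q : ℂ} {γ γ₁ γ₂ : CurveClass ℂ}
    (h₁ : IsMoveVia D κ p q γ γ₁) (h₂ : IsMoveVia D κ p q γ γ₂) : γ₁ = γ₂ :=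
  CurveClass.eq_of_mem_simple_of_range_eq h₁.2.1.simple h₂.2.1.simple
    (h₁.2.2.2.2.2.2.2.trans h₂.2.2.2.2.2.2.2.symm) (h₁.2.1.source_eq.trans h₂.2.1.source_eq.symm)

open Classical in
/-- The move map: the (unique) result of the move `m = (κ, p, q)` on `γ` when admissible and
non-trivial, else `γ` itself (the lattice accept/reject rule). -/
def moveOf (D : DobrushinDomain) (m : MoveKind × ℂ × ℂ) (γ : CurveClass ℂ) : CurveClass ℂ :=
  if h : ∃ γ', IsMoveVia D m.1 m.2.1 m.2.2 γ γ' then h.choose else γ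

/-- The parameter window of kind `κ` with pivots in `U × V`. -/
def window (κ : MoveKind) (U V : Set ℂ) : Set (MoveKind × ℂ × ℂ) :=
  {m | m.1 = κ ∧ m.2.1 ∈ U ∧ m.2.2 ∈ V}

/-! ## §2 The pivot structure a subsequential limit inherits: a pair-intensity kernel

`K γ` is a finite measure on move parameters `(κ, p, q)` — the renormalised `δ → 0` limit of the
counting measure of ACCEPTED lattice pivot pairs at mutual distance `≥ r` (normalised by its mean
`c_δ → ∞`). The clauses are exactly what the lattice identity plus the a-priori estimates of the card
deliver and what rigidity consumes; each one is load-bearing against a cheap counterexample (see the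
line card): `balance` = (CS) detailed balance; `ample` = L1″ (every admissible window is charged —
kills conditioned SLE and fixed-mesh laws); `isLocal` = L1‴ (kernel fixed by local geometry — kills
the measure-class cheat `h·SLE` with kernel `h⁻¹ K`); `ae_pos` = every typical curve moves (kills the
Dirac mass on the straight segment, which has no non-trivial move); `supported` = moves are
admissible, non-trivial and macroscopic. -/

/-- **Pivot kernel at scale `r` for `μ` in `(D; a, b)`.** -/
structure IsPivotKernel (D : DobrushinDomain) (r : ℝ) (μ : Measure (CurveClass ℂ))
    (K : CurveClass ℂ → Measure (MoveKind × ℂ × ℂ)) : Prop where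
  /-- measurability of the kernel -/
  measurable : ∀ s : Set (MoveKind × ℂ × ℂ), MeasurableSet s → Measurable fun γ => K γ s
  /-- each `K γ` is a finite measure … -/
  isFiniteMeasure : ∀ γ, IsFiniteMeasure (K γ)
  /-- … of integrable total mass (`E|K| < ∞`; the lattice normalisation is `E|K_δ| = 1`) -/
  integrable : ∫⁻ γ, K γ univ ∂μ ≠ ⊤
  /-- almost every curve moves (normalised accepted-pair counts do not degenerate) -/
  ae_pos : ∀ᵐ γ ∂μ, K γ univ ≠ 0
  /-- the kernel charges only admissible, non-trivial moves at pivot distance `≥ r` -/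
  supported : ∀ᵐ γ ∂μ, ∀ᵐ m ∂(K γ), r ≤ dist m.2.1 m.2.2 ∧ ∃ γ', IsMoveVia D m.1 m.2.1 m.2.2 γ γ'
  /-- **(CS) detailed balance**: the flux `μ(dγ) K_γ(dm) δ_{(γ, T_m γ)}` is swap-symmetric -/
  balance : ∀ F : CurveClass ℂ × CurveClass ℂ → ℝ≥0∞, Measurable F →
    ∫⁻ γ, (∫⁻ m, F (γ, moveOf D m γ) ∂(K γ)) ∂μ = ∫⁻ γ, (∫⁻ m, F (moveOf D m γ, γ) ∂(K γ)) ∂μ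
  /-- **ample** (L1″): every window containing an admissible move at pivot distance `> r` is charged -/
  ample : ∀ᵐ γ ∂μ, ∀ (κ : MoveKind) (U V : Set ℂ), IsOpen U → IsOpen V →
    (∃ p ∈ U, ∃ q ∈ V, r < dist p q ∧ ∃ γ', IsMoveVia D κ p q γ γ') → K γ (window κ U V) ≠ 0
  /-- **local** (L1‴): on a full-measure Borel set, two curves with the same trace near the pivot
  windows and the same admissible moves there have the same kernel there -/
  isLocal : ∃ G : Set (CurveClass ℂ), MeasurableSet G ∧ μ Gᶜ = 0 ∧
    ∀ γ₁ ∈ G, ∀ γ₂ ∈ G, ∀ (κ : MoveKind) (U V : Set ℂ) (ε : ℝ), IsOpen U → IsOpen V → 0 < ε →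
      γ₁.range ∩ Metric.cthickening ε (U ∪ V) = γ₂.range ∩ Metric.cthickening ε (U ∪ V) →
      (∀ p ∈ U, ∀ q ∈ V, (∃ γ', IsMoveVia D κ p q γ₁ γ') ↔ (∃ γ', IsMoveVia D κ p q γ₂ γ')) →
      (K γ₁).restrict (window κ U V) = (K γ₂).restrict (window κ U V)

/-- `μ` carries pivot kernels at all small scales. -/
def HasPivotKernels (D : DobrushinDomain) (μ : Measure (CurveClass ℂ)) : Prop :=
  ∃ r₀ : ℝ, 0 < r₀ ∧ ∀ r : ℝ, 0 < r → r ≤ r₀ → ∃ K, IsPivotKernel D r μ K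

/-! ## §3 Move-invariant tilts of the chordal SLE_{8/3} law (the conclusion class of rigidity) -/

/-- `h` is invariant under all admissible two-point moves between curves of `G`. -/
def IsMoveInvariantOn (D : DobrushinDomain) (G : Set (CurveClass ℂ)) (h : CurveClass ℂ → ℝ≥0∞) :
    Prop :=
  ∀ r : ℝ, 0 < r → ∀ γ ∈ G, ∀ γ' ∈ G, IsMove D r γ γ' → h γ = h γ'

/-- `μ = h · ν` for an SLE_{8/3}(D) law `ν` and a density `h` that is move-invariant on a Borel set of
full `ν`-measure. Every such `μ` is balanced for the kernel of `ν` (triage r1-1 (c), r1-3: e.g.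
`h = φ(M)`, `M` the `4/3`-Minkowski content `HasMinkowskiContent (4/3)` of the trace, which is
move-invariant since moves are isometries on a sub-arc); rigidity bets on the converse. -/
def IsMoveInvariantTilt (D : DobrushinDomain) (μ : Measure (CurveClass ℂ)) : Prop :=
  ∃ (ν : Measure (CurveClass ℂ)) (h : CurveClass ℂ → ℝ≥0∞) (G : Set (CurveClass ℂ)),
    IsSLELaw ((8 : ℝ≥0) / 3) D ν ∧ IsProbabilityMeasure ν ∧ Measurable h ∧ MeasurableSet G ∧
      ν Gᶜ = 0 ∧ IsMoveInvariantOn D G h ∧ μ = ν.withDensity h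

/-! ## §4 Two-copy arc swaps (M4) and swap-intensity kernels -/

/-- The trace of copy 1 after exchanging its sub-arc between the common points `p, q` for copy 2's. -/
def swappedRange (R₁ R₂ : Set ℂ) (p q : ℂ) : Set ℂ :=
  (R₁ \ subarc R₁ p q) ∪ subarc R₂ p q

/-- `x'` is obtained from the pair `x = (γ₁, γ₂)` of simple chords of `D₁`, `D₂` by the ADMISSIBLE,
NON-TRIVIAL swap of the sub-arcs between the common points `p ≠ q`. -/
def IsSwapVia (D₁ D₂ : DobrushinDomain) (p q : ℂ) (x x' : CurveClass ℂ × CurveClass ℂ) : Prop :=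
  D₁.IsSimpleChord x.1 ∧ D₂.IsSimpleChord x.2 ∧ D₁.IsSimpleChord x'.1 ∧ D₂.IsSimpleChord x'.2 ∧
    x' ≠ x ∧ p ∈ x.1.range ∩ x.2.range ∧ q ∈ x.1.range ∩ x.2.range ∧ p ≠ q ∧
    x'.1.range = swappedRange x.1.range x.2.range p q ∧
    x'.2.range = swappedRange x.2.range x.1.range p q

open Classical in
/-- The swap map (accept/reject rule). -/
def swapOf (D₁ D₂ : DobrushinDomain) (c : ℂ × ℂ) (x : CurveClass ℂ × CurveClass ℂ) :
    CurveClass ℂ × CurveClass ℂ :=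
  if h : ∃ x', IsSwapVia D₁ D₂ c.1 c.2 x x' then h.choose else x

/-- **Swap kernel at scale `r` for the pair law `ρ` (intended: `ρ = μ₁ ⊗ μ₂`).** Same clauses as
`IsPivotKernel` (no `ae_pos`: two independent chords need not meet; ampleness covers the pairs that
admit swaps). -/
structure IsSwapKernel (D₁ D₂ : DobrushinDomain) (r : ℝ) (ρ : Measure (CurveClass ℂ × CurveClass ℂ))
    (S : CurveClass ℂ × CurveClass ℂ → Measure (ℂ × ℂ)) : Prop where
  measurable : ∀ s : Set (ℂ × ℂ), MeasurableSet s → Measurable fun x => S x s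
  isFiniteMeasure : ∀ x, IsFiniteMeasure (S x)
  integrable : ∫⁻ x, S x univ ∂ρ ≠ ⊤
  supported : ∀ᵐ x ∂ρ, ∀ᵐ c ∂(S x), r ≤ dist c.1 c.2 ∧ ∃ x', IsSwapVia D₁ D₂ c.1 c.2 x x'
  balance : ∀ F : (CurveClass ℂ × CurveClass ℂ) × (CurveClass ℂ × CurveClass ℂ) → ℝ≥0∞,
    Measurable F →
    ∫⁻ x, (∫⁻ c, F (x, swapOf D₁ D₂ c x) ∂(S x)) ∂ρ = ∫⁻ x, (∫⁻ c, F (swapOf D₁ D₂ c x, x) ∂(S x)) ∂ρ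
  ample : ∀ᵐ x ∂ρ, ∀ (U V : Set ℂ), IsOpen U → IsOpen V →
    (∃ p ∈ U, ∃ q ∈ V, r < dist p q ∧ ∃ x', IsSwapVia D₁ D₂ p q x x') → S x (U ×ˢ V) ≠ 0
  isLocal : ∃ G : Set (CurveClass ℂ × CurveClass ℂ), MeasurableSet G ∧ ρ Gᶜ = 0 ∧
    ∀ x₁ ∈ G, ∀ x₂ ∈ G, ∀ (U V : Set ℂ) (ε : ℝ), IsOpen U → IsOpen V → 0 < ε →
      x₁.1.range ∩ Metric.cthickening ε (U ∪ V) = x₂.1.range ∩ Metric.cthickening ε (U ∪ V) →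
      x₁.2.range ∩ Metric.cthickening ε (U ∪ V) = x₂.2.range ∩ Metric.cthickening ε (U ∪ V) →
      (∀ p ∈ U, ∀ q ∈ V, (∃ x', IsSwapVia D₁ D₂ p q x₁ x') ↔ (∃ x', IsSwapVia D₁ D₂ p q x₂ x')) →
      (S x₁).restrict (U ×ˢ V) = (S x₂).restrict (U ×ˢ V)

/-! ## §5 The statements of the line -/

/-- The hypotheses of the crux, bundled: `μ` is a weak subsequential limit of the critical SAW laws of
`(D; a, b)` along the endpoint approximation `(a_δ, b_δ)` and the meshes `s n → 0⁺`. -/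
def IsSubseqLimit (D : DobrushinDomain) (a b : ℝ → Site 2) (s : ℕ → ℝ) (μ : Measure (CurveClass ℂ)) :
    Prop :=
  IsEndpointApprox D a b ∧ Tendsto s atTop (𝓝[>] (0 : ℝ)) ∧ IsProbabilityMeasure μ ∧
    ∀ f : CurveClass ℂ →ᵇ ℝ, Tendsto (fun n => ∫ γ, f γ.curve
      ∂(SAW.law D.carrier (s n) (a (s n)) (b (s n)))) atTop (𝓝 (∫ x, f x ∂μ))

/-- **S1 (L1′ ∧ L1″ ∧ L1‴) — the Campbell/detailed-balance limit.** Every subsequential limit carried by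
simple chords inherits pivot kernels at all small scales. -/
def PivotKernelLimit : Prop :=
  ∀ (D : DobrushinDomain) (a b : ℝ → Site 2) (s : ℕ → ℝ) (μ : Measure (CurveClass ℂ)),
    IsSubseqLimit D a b s μ → (∀ᵐ γ ∂μ, D.IsSimpleChord γ) → HasPivotKernels D μ

/-- **S2 (L3, restated by triage) — PIVOT RIGIDITY, the crux of the line.** A probability law on simple
chords of `(D; a, b)` with pivot kernels at all small scales is a move-invariant tilt of the chordal
SLE_{8/3} law of `D`. -/
def PivotRigidity : Prop :=
  ∀ (D : DobrushinDomain) (μ : Measure (CurveClass ℂ)), IsProbabilityMeasure μ →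
    (∀ᵐ γ ∂μ, D.IsSimpleChord γ) → HasPivotKernels D μ → IsMoveInvariantTilt D μ

/-- **S3 (M4) — the swap limit.** Two subsequential limits along the SAME meshes, each carried by simple
chords, inherit swap kernels for their product at every scale. -/
def SwapKernelLimit : Prop :=
  ∀ (D₁ D₂ : DobrushinDomain) (a₁ b₁ a₂ b₂ : ℝ → Site 2) (s : ℕ → ℝ)
    (μ₁ μ₂ : Measure (CurveClass ℂ)),
    IsSubseqLimit D₁ a₁ b₁ s μ₁ → IsSubseqLimit D₂ a₂ b₂ s μ₂ →
    (∀ᵐ γ ∂μ₁, D₁.IsSimpleChord γ) → (∀ᵐ γ ∂μ₂, D₂.IsSimpleChord γ) →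
    ∀ r : ℝ, 0 < r → ∃ S, IsSwapKernel D₁ D₂ r (μ₁.prod μ₂) S

/-- S1 ∧ S2 for every subsequential limit (what `stub_untilt` may use on its auxiliary limits). -/
def MoveInvariantTiltAll : Prop :=
  ∀ (D : DobrushinDomain) (a b : ℝ → Site 2) (s : ℕ → ℝ) (μ : Measure (CurveClass ℂ)),
    IsSubseqLimit D a b s μ → IsMoveInvariantTilt D μ

/-- S3 for every pair of subsequential limits (idem). -/
def SwapKernelAll : Prop :=
  ∀ (D₁ D₂ : DobrushinDomain) (a₁ b₁ a₂ b₂ : ℝ → Site 2) (s : ℕ → ℝ)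
    (μ₁ μ₂ : Measure (CurveClass ℂ)),
    IsSubseqLimit D₁ a₁ b₁ s μ₁ → IsSubseqLimit D₂ a₂ b₂ s μ₂ →
    ∀ r : ℝ, 0 < r → ∃ S, IsSwapKernel D₁ D₂ r (μ₁.prod μ₂) S

/-- **S4 (L3⊗ ∧ exact scaling ∧ L5) — UNTILTING.** A subsequential SAW limit that is a move-invariant
tilt `h · ν` of an SLE_{8/3}(D) law is that law. -/
def Untilt : Prop :=
  ∀ (D : DobrushinDomain) (a b : ℝ → Site 2) (s : ℕ → ℝ) (μ : Measure (CurveClass ℂ)),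
    IsSubseqLimit D a b s μ →
    ∀ (ν : Measure (CurveClass ℂ)) (h : CurveClass ℂ → ℝ≥0∞) (G : Set (CurveClass ℂ)),
      IsSLELaw ((8 : ℝ≥0) / 3) D ν → IsProbabilityMeasure ν → Measurable h → MeasurableSet G →
      ν Gᶜ = 0 → IsMoveInvariantOn D G h → μ = ν.withDensity h → μ = ν

/-! ## §6 The four stubs (registered; `sorry` only here) -/

/-- **stub_pivotKernel (S1; lattice → continuum; size XL).** For `μ` a subsequential limit of the
critical SAW in `(D; a, b)` carried by simple chords: fix `r > 0` small; at mesh `s n` let `N_δ(γ)` be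
the number of index pairs `i < j` with `|γ_i - γ_j| ≥ r` and a kind `κ` (the four lattice mirrors
through `γ_i, γ_j` when these lie on a common lattice line of that direction; the half-turn about
`(γ_i+γ_j)/2`; the lattice bisector reflections) whose move is ACCEPTED (image a SAW of `Ω_δ`) and
non-trivial, `c_δ = E_δ N_δ`. (i) `pivotFlux_symm` summed over moves: the lattice flux
`Θ_δ = Σ (id, T_{ijκ})_* P_δ` is symmetric and `Θ_δ = P_δ(dγ) K_δ,γ` with `K_δ` the counting kernel;
(ii) ABUNDANCE + UNIFORM INTEGRABILITY (the one a-priori estimate L1′: `sup_δ E_δ (N_δ/c_δ)² < ∞`, a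
4-arm-type second-moment count at `x_c`; heuristic count of admissible pairs `≍ δ^{-1.78}` (M2),
`δ^{-0.78}` (M1), triage r1-3 App. A) make `{c_δ⁻¹ Θ_δ}` tight with u.i. marginal densities; (iii)
along a sub-subsequence `(γ, c_δ⁻¹K_δ,γ) ⇒` a flux whose disintegration `K_γ := E[K | γ]` is the
kernel: `balance` passes to the limit because `(γ, p, q) ↦ T_{pq}γ` is continuous at simple `γ` for
admissible moves with clearance (this is where L6 = simplicity is consumed), `supported` by
portmanteau on the closed admissibility relation, `ae_pos`/`ample` are the LOWER bounds (L1″: every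
admissible window of a typical curve carries `≍ c_δ ×` (window size) accepted pairs — local abundance,
0–1-law type), `isLocal` (L1‴) is the statement that given macroscopic admissibility the acceptance of
nearby lattice pairs is decided inside small balls around `p` and `q`, so that `E[K|γ]` on a window is
a functional of `γ` near the window. Leans on: `pivotFlux_symm`, `CurveClass.polishSpace_holds`,
Prokhorov, `CurveClass.eq_of_mem_simple_of_range_eq`; MadrasSlade1993 §9.4 (acceptance exponent
`p ≈ 0.19`), §9.6.2; Kennedy arXiv:cond-mat/0109308 (pivot counts). Why it might fail: the u.i. bound
(exploding variance of accepted-pair counts) or locality of the conditional intensity. -/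
theorem stub_pivotKernel : PivotKernelLimit := by
  sorry

/-- **stub_pivotRigidity (S2; continuum measure rigidity; size XXL — the HARDEST stub, the bet).**
`μ` probability on simple chords of `(D; a, b)` + pivot kernels at all scales `r ≤ r₀` ⇒
`μ = h · SLE_{8/3}(D)` with `h` move-invariant. Mechanism (why plausibly true): disintegrate `balance`
over the outer arcs; at a charged pivot `p` the move re-pairs the incoming germ of `γ` with the MIRROR
of the outgoing germ of the middle arc, and the re-paired germ law is absolutely continuous w.r.t.
the original one iff the central charge vanishes — for `κ ≠ 8/3` the log-density is the Brownian-loop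
cocycle `(c/2)(Λ_{D′}(η, D′∖D″) - Λ_{σD′}(η, σD′∖D″))`, NON-LOCAL in the middle arc `η` and divergent
down the scales at `p`, contradicting `balance ∧ isLocal`; for `c = 0` restriction makes both sides
`SLE_{8/3}(D′ ∩ σD′; p, q)` (`sle_restriction_eightThirds_holds`,
`IsSLELaw.hullRestriction_eightThirds_holds`), σ-symmetric. MODULUS (PIN half): for an affine /
quasiconformal image `ψ_* SLE_{8/3}` the conjugated diagonal mirrors `ψ⁻¹σψ` are not isometries, so
balance forces the Beltrami coefficient to be mirror-symmetric in four directions a.e., hence `0`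
(stabiliser programme "Stab(SLE_{8/3}) = (anti)conformal maps", route SAWRestrictionDescent; triage
r1-2 (a1): an affine involution preserves Schramm's foliation iff `λ = 1`). SIMPLICITY is
load-bearing (locality laws, `κ = 6`, pass every move test but are not simple). `ample` excludes
conditioned SLE (`1_E/P(E) · SLE`: moves leaving `E` would have to be uncharged), `isLocal` excludes
`h · SLE` with non-invariant `h` (its only balanced kernel is `h⁻¹K`, not local), `ae_pos` excludes the
Dirac mass on a straight segment (no non-trivial move). What remains is QCU ("a balanced, ample, local
law on simple chords is SLE_{8/3} in some measurable conformal gauge, up to an invariant density") —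
the open core, Kennedy's continuum-pivot question in two-point form. Leans on: restriction theory
`IsRestrictionMeasure.*`, `sle_restriction_eightThirds_holds`, `TopologicalSLE` /
`ChordalFamily.isTopologicalSLEAt_of_isSLELaw`, `IsSLELaw.unique`, `exists_isSLECurve_eightThirds`,
Brownian loop measure files (c ≠ 0 side), LSW03 arXiv:math/0209343, Beffara arXiv:0708.3908,
Zhan arXiv:0808.3649 (reversibility). Why it might fail: an exotic non-SLE-class law with an
absolutely continuous germ re-pairing (no mechanism known either way). -/
theorem stub_pivotRigidity : PivotRigidity := by
  sorry

/-- **stub_swapKernel (S3; lattice → continuum; size XL).** At one mesh the product of two critical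
SAW laws (any two domains and endpoint pairs) is uniform given the TOTAL length, hence invariant under
every arc swap between two common vertices composed with accept/reject (a length-sum-preserving
involution of `DomainSAW¹ × DomainSAW²`; same proof as `law_map_eq_of_length_preserving` on the
product), so the two-copy flux is symmetric at every mesh; normalise the counting measure of accepted
macroscopic swaps and pass to the limit exactly as in `stub_pivotKernel`. The a-priori input is SWAP
ABUNDANCE: the re-pairing cost at a crossing of two independent critical walks must satisfy
`2ζ₄ < 4/3` (packet/KPZ count `x(K₂,₂) ≈ 1.655 < 2`, admissible swap pairs of dimension `≈ 0.69 > 0`,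
triage r1-3 App. A) together with a second-moment bound — the card's falsifier (c), "the first thing
to run" (triage r1-3). Why it might fail: `2ζ₄ ≥ 4/3` (swaps die in the limit: `S = 0`, `ample`
false), or exploding variance. Leans on: the product version of `pivotFlux_symm`, Prokhorov on
`(CurveClass ℂ)²`, L6 for both copies. -/
theorem stub_swapKernel : SwapKernelLimit := by
  sorry

/-- **stub_untilt (S4; size XL; first candidate for a glued split).** Given (T′) eventual tightness
(auxiliary subsequential limits exist along sub-subsequences), S1 ∧ S2 for all subsequential limits
and S3 for all pairs: a subsequential limit `μ = h · ν`, `ν = SLE_{8/3}(D)`, `h` move-invariant, has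
`h ≡ 1`. Plan: (a) CAUCHY STEP (L3⊗, continuum, provable-now-sized given the kernels): swap balance
between `μ` and an auxiliary limit `μ' = h'ν'` whose chords cross those of `μ` forces
`h(γ₁)h'(γ₂) = h(γ₁')h'(γ₂')` along charged swaps; with move-invariance this makes `-log h` an
ADDITIVE isometry-invariant functional of the trace with a rate common to both copies — for the
expected invariant, the `4/3`-Minkowski content `M` (`HasMinkowskiContent (4/3)`, Lawler–Rezaei
arXiv:1211.4146), `h = e^{-sM}/Z_s` ("massive SLE_{8/3}", lattice shadow: the near-critical window
`x = x_c - s·c·δ^{4/3}`, which satisfies every pivot identity the critical walk does); (b) EXACT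
LATTICE SCALING: for a lattice square `Q ⊆ D` with corner `0` and boundary pairs `P_k = 2^{-k}(A, B)`
on its two sides, `meshDomain (Q/2) (δ/2) = meshDomain Q δ`, so
`Law(Q; P_{k+1}; δ/2 | γ ⊆ Q/2) = (z ↦ z/2)_* Law(Q; P_k; δ)` EXACTLY (restriction + scaling of
`SAW.law`, triage r1-1 (e)); in the limit along `seq/2` this reads `s_{k+1}(seq/2) = 2^{4/3} s_k(seq)`
while swap balance between the walks of `P_k` and `P_{k+1}` (they meet near the corner) gives
`s_{k+1} = s_k` at each sequence, so `s(seq/2^j) = 2^{4j/3} s(seq)`; (c) L5, UNIFORM TWO-SIDED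
NON-DEGENERACY along the corner chain (embedding-blind, tightness-class: rescaled limits neither
escape nor concentrate in tubes, uniformly in `k`; consecutive walks meet with probability `≥ c`) bounds
the rates, so `s ≡ 0`; one more swap between the crux's walk and the auxiliary walk in `Q ⊆ D`
transfers `s = 0` to `μ`, i.e. `h ≡ 1`. Uses `EventualTight` for the auxiliary limits (diagonal
sub-subsequences), `MoveInvariantTiltAll` to know they are tilts, `SwapKernelAll` for the swaps.
Why it might fail: an additive move-invariant functional other than the content with no scaling law
(then (b) needs its own covariance), or failure of L5 (escape of mass along the corner chain). Glued
split when attacked: `Untilt ⇐ SwapCauchy ∧ CornerScaling ∧ CornerNonDegeneracy`. -/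
theorem stub_untilt : EventualTight → MoveInvariantTiltAll → SwapKernelAll → Untilt := by
  sorry

/-! ## §7 Composition (sorry-free): the stubs and the two registered obligations prove the crux BY NAME -/

/-- **The hypothesis L6 costs nothing**: `SimpleSubseqLimits` (stmt-CriticalPhenomena-4982) is
NECESSARY for the crux — an SLE_{8/3} law is carried by simple chords (landed Negative lemma
`SimpleSubseqLimits.Negative.ae_carrier_of_isSLELaw`, Rohde–Schramm input discharged in tree), cf.
`SimpleSubseqLimits.Negative.not_subseqIdentification_of_not_simpleSubseqLimits` for the verbatim-equal
`SAWLoopFugacityFlow` copy of the crux decl. [folklore] -/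
theorem simpleSubseqLimits_of_subseqIdentification (hI : SubseqIdentification) : SimpleSubseqLimits :=
  fun D a b hab s ν hs hν hw =>
    Summit.CriticalPhenomena.SAWScalingLimit.Theorems.SimpleSubseqLimits.Negative.ae_carrier_of_isSLELaw
      (hI D a b hab s ν hs hν hw)

/-- **The line closes the crux.** From the registered obligations `EventualTight`
(stmt-CriticalPhenomena-1372, this route's target (T′)) and `SimpleSubseqLimits`
(stmt-CriticalPhenomena-4982 = L6; necessary for the crux by
`SimpleSubseqLimits.Negative.not_subseqIdentification_of_not_simpleSubseqLimits`) and the four stubs: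
S1+S2 make every subsequential limit a move-invariant tilt of SLE_{8/3}(D), S3 supplies the swap
kernels, S4 untilts. -/
theorem SubseqIdentification_of (hT : EventualTight) (hS : SimpleSubseqLimits) :
    SubseqIdentification := by
  intro D a b hab s μ hs hμ hlim
  have hsub : IsSubseqLimit D a b s μ := ⟨hab, hs, hμ, hlim⟩
  -- L6: every subsequential limit is carried by simple chords of its domain
  have hsimple : ∀ {D : DobrushinDomain} {a b : ℝ → Site 2} {s : ℕ → ℝ}
      {μ : Measure (CurveClass ℂ)}, IsSubseqLimit D a b s μ → ∀ᵐ γ ∂μ, D.IsSimpleChord γ :=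
    fun {D a b s μ} h => hS D a b h.1 s μ h.2.1 h.2.2.1 h.2.2.2
  -- S1 + S2: every subsequential limit is a move-invariant tilt of the SLE_{8/3} law of its domain
  have hTilt : MoveInvariantTiltAll := fun D a b s μ h =>
    stub_pivotRigidity D μ h.2.2.1 (hsimple h) (stub_pivotKernel D a b s μ h (hsimple h))
  -- S3: swap kernels for every pair of subsequential limits along the same meshes
  have hSwap : SwapKernelAll := fun D₁ D₂ a₁ b₁ a₂ b₂ s μ₁ μ₂ h₁ h₂ r hr =>
    stub_swapKernel D₁ D₂ a₁ b₁ a₂ b₂ s μ₁ μ₂ h₁ h₂ (hsimple h₁) (hsimple h₂) r hr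
  -- S4: untilt the limit at hand
  obtain ⟨ν, h, G, hν, hνp, hh, hG, hGc, hinv, hμν⟩ := hTilt D a b s μ hsub
  have hμν' : μ = ν := stub_untilt hT hTilt hSwap D a b s μ hsub ν h G hν hνp hh hG hGc hinv hμν
  rw [hμν']
  exact hν

end Summit.CriticalPhenomena.SAWScalingLimit.Cruxes.SubseqIdentification.TwoPointPivotRigidity

end
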